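import Mathlib
import HarnessLib
import Literature.Analysis.FluidPDE.TypeIAncientMildRescale
import Literature.Analysis.FluidPDE.AxisymmetricEuler
import Summits.NavierStokesRegularity.NavierStokesRegularity.Theorems.PoloidalWindowDoorPoloidalWindowRigidityNearIdentityDefs
import Summits.NavierStokesRegularity.NavierStokesRegularity.Theorems.PoloidalWindowDoorPoloidalWindowRigidityWindow
import Summits.NavierStokesRegularity.NavierStokesRegularity.Theorems.SymmetryModuliCountAxisymEndLiouville

/-!
# Route `PoloidalWindowDoor`, crux `PoloidalWindowRigidity` (K2, stmt-NavierStokesRegularity-19708) — THICK column, LINE 29 «near_identity» §34, PORTED: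
# the AXISYMMETRIC END of a one-parameter symmetry is absurd in the class (tree `AxisymEndLiouville` by name)

Seat ns-poloidal-K2-p2 g15 (DIRECTOR-NS #306, idea-crit-7's errand R2; `--supports stmt-NavierStokesRegularity-19708 --as helper`).  Source:
`Cruxes/PoloidalWindowRigidity/Lines/near_identity.lean` 63c9d39e624d §34 VERBATIM (`Pinned` unfolded; `class_of_pinned` = `…Window.isTypeIAncientMild_of_class`).
Kept in its own file because it imports `…SymmetryModuliCountAxisymEndLiouville`, which lies in the cone of the route file `Theses.SymmetryModuliCount`
(`lint.theses-cone`); the rest of the §32–§34 port (`…NearIdentityExtraction`) is cone-free.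

* `axisymmetric_absurd` — an axisymmetric profile of the Type-I ancient mild class is `≡ 0`: the swirl dies by the weighted comparison of the tree's
  «absorbing-axis-swirl-extinction» (`stub_swirlWeightProfile`, `stub_swirlComparison`), then KNSS 2009 Thm 5.2 in the mild gauge (`stub_noSwirlLiouville`).
* `not_axisymmetric_pinned` — no pinned profile is axisymmetric about any vertical axis.

WHAT THIS IS NOT: not a claim about Navier–Stokes regularity — a ported support (bears_on LADDER-NS N0, rung N0-LocalTubeDoorPoloidal); 19708 / 20428 OPEN.
-/

noncomputable section

-- the summit and its single sub-problem share the name (CONVENTIONS §1), as in every Theorems file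
set_option linter.dupNamespace false

namespace Summit.NavierStokesRegularity.NavierStokesRegularity.Theorems.PoloidalWindowDoorPoloidalWindowRigidityNearIdentityAxisymEnd

open Set Function Filter Topology Metric
open scoped InnerProductSpace RealInnerProductSpace Laplacian NNReal
open Literature.Analysis Literature.Analysis.FluidPDE Literature.Analysis.UnboundedOperators
open Summit.NavierStokesRegularity.NavierStokesRegularity.Theorems

/-- **An axisymmetric profile of the class is trivial (PROVED, tree by name):** the swirl dies by the weighted comparison of the tree's line
«absorbing-axis-swirl-extinction» (`stub_swirlWeightProfile`, `stub_swirlComparison`, swirl ALLOWED, NO spatial decay), then KNSS 2009 Thm 5.2 in the mild gauge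
(`stub_noSwirlLiouville`) — exactly the tail of the tree's `…Theorems.AxisymEndLiouville_of` (crux `SymmetryModuliCount.AxisymEndLiouville`, stmt-14061, CLOSED). -/
theorem axisymmetric_absurd {C : ℝ} {u : ℝ → EuclideanSpace ℝ (Fin 3) → EuclideanSpace ℝ (Fin 3)} (hu : IsTypeIAncientMild C u)
    (haxi : ∀ t < 0, IsAxisymmetric (u t)) : ∀ t < 0, ∀ x, u t x = 0 := by
  have hC : 0 ≤ C := hu.nonneg
  obtain ⟨lam, K, hlam, hK, W, hWc, hW2, hW0, hWK, hW1, hWineq⟩ :=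
    AxisymEndLiouville.AbsorbingAxisSwirlExtinction.stub_swirlWeightProfile C hC
  have hsw : ∀ t < 0, HasNoSwirl (u t) := by
    intro t ht y
    refine abs_nonpos_iff.1 (le_of_forall_pos_le_add fun η hη => ?_)
    obtain ⟨t', ht', hle⟩ := exists_past_rpow_mul_le (C * K * W (cylRadius y / Real.sqrt (-t))) hlam ht hη
    have key := AxisymEndLiouville.AbsorbingAxisSwirlExtinction.stub_swirlComparison C lam K W hlam hK hWc hW2 hW0 hWK hW1 hWineq u hu haxi
      t' t ht' ht y
    calc |swirl (u t) y| ≤ C * K * (t / t') ^ lam * W (cylRadius y / Real.sqrt (-t)) := key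
      _ = C * K * W (cylRadius y / Real.sqrt (-t)) * (t / t') ^ lam := by ring
      _ ≤ η := hle
      _ ≤ 0 + η := by rw [zero_add]
  exact AxisymEndLiouville.AbsorbingAxisSwirlExtinction.stub_noSwirlLiouville C u hu haxi hsw

/-- **NO PINNED PROFILE IS AXISYMMETRIC ABOUT ANY VERTICAL AXIS (PROVED, unconditional):** the translate is an axisymmetric class profile, hence `0`
(`axisymmetric_absurd`), but the pin `N ≠ 0` sits on it. -/
theorem not_axisymmetric_pinned {C : ℝ} {v : ℝ → EuclideanSpace ℝ (Fin 3) → EuclideanSpace ℝ (Fin 3)} {c : EuclideanSpace ℝ (Fin 3)} (hP : (Literature.Analysis.FluidPDE.HasTypeITimeDecay C v ∧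
        ContinuousOn (Function.uncurry v) (Set.Iio (0 : ℝ) ×ˢ Set.univ) ∧
        (∀ s t : ℝ, s < t → t < 0 → ∀ x, v t x =
          Literature.Analysis.UnboundedOperators.heatExtension (v s) (t - s) x -
            Literature.Analysis.FluidPDE.oseenDuhamel 1 s v v t x) ∧
        (∀ t < 0, Literature.Analysis.FluidPDE.VectorCalculus.IsDivFree (v t)) ∧
        (∀ s < 0, ∀ q, ⟪Literature.Analysis.FluidPDE.curl (v s) q, EuclideanSpace.single 2 1⟫_ℝ = 0) ∧
        v (-1) 0 2 ≠ 0 ∧ (∀ t < 0, ∀ x, Real.sqrt (-t) * |v t x 2| ≤ |v (-1) 0 2|) ∧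
        (∀ h : EuclideanSpace ℝ (Fin 3), fderiv ℝ (v (-1)) 0 h 2 = 0) ∧
        (deriv (fun s => v s 0 2) (-1) = v (-1) 0 2 / 2 ∧ v (-1) 0 2 * (Δ (fun q => v (-1) q 2)) 0 ≤ 0)))
    (haxi : ∀ t < 0, IsAxisymmetric (fun x => v t (x + c))) : False := by
  have hw : IsTypeIAncientMild C (fun t x => v t (x + c)) := (PoloidalWindowDoorPoloidalWindowRigidityWindow.isTypeIAncientMild_of_class hP.1 hP.2.1 hP.2.2.1 hP.2.2.2.1).comp_add_right c
  have h0 := axisymmetric_absurd hw haxi (-1) (by norm_num) (-c)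
  have h1 : v (-1) 0 = 0 := by simpa using h0
  exact hP.2.2.2.2.2.1 (by rw [h1]; rfl)


end Summit.NavierStokesRegularity.NavierStokesRegularity.Theorems.PoloidalWindowDoorPoloidalWindowRigidityNearIdentityAxisymEnd

end
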